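import Literature.Combinatorics.Sahi2008.Functional

/-!
# `NoHeavyLowerTail` (stmt-CriticalPhenomena-4575) — the LAW OF TOTAL `E₃` (conditioning Sahi's third functional on
# partial information) and the mixed term that obstructs coordinate induction

Support file of the `|A| = 5` / master-family surge, seat `prim-l12-p5`, `--supports stmt-CriticalPhenomena-4575`.
Everything PROVED (pure algebra); no definitions, no named facts.

## Statement

Let `(Ω, μ)` be a finite probability space, `ℱ` a sub-σ-algebra (e.g. "the first `j` coordinates of `{0,1}^k`"), and for
functions `f₁, f₂, f₃` put `m_a = E[f_a | ℱ]`, `K_bc = Cov(f_b, f_c | ℱ)`, `E₃(f | ℱ)` = Sahi's third functional computed under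
the conditional law.  Then (`{a,b,c} = {1,2,3}`)

  `E₃(f₁,f₂,f₃) = E[ E₃(f₁,f₂,f₃ | ℱ) ] + E₃(m₁,m₂,m₃) + Σ_a Cov(m_a, K_bc).`                                    (T)

This is the order-3 analogue of the law of total covariance `Cov(f,g) = E Cov(f,g|ℱ) + Cov(E f|ℱ, E g|ℱ)` (which, read along
one coordinate at a time, IS the martingale proof of Harris' inequality); it follows from Brillinger's law of total cumulance
for `κ₃` [Brillinger 1969, "The calculation of cumulants via conditioning", Ann. Inst. Statist. Math. 21, 215–218] together
with `E₃ = 2κ₃ + Σ_a E(f_a)·Cov(f_b,f_c)`.  For a product measure and `ℱ = σ(x_S)` the first two terms of (T) are instances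
of `C₃` on fewer coordinates (the conditional law is again a product measure; the `m_a` are monotone `[0,1]`-valued), so

  `C₃` for all product measures  ⟸  the MIXED TERM `Σ_a Cov(E[f_a|x_S], Cov(f_b,f_c|x_S))` is `≥ 0`,

and the mixed term is exactly where monotonicity is lost (`x_S ↦ Cov(f_b,f_c|x_S)`, joint pivotality, is not monotone).
Census (seat, exact rationals, `work/py/martingale_e3.py`): iterating (T) one bit at a time gives
`E₃ = Σ_j q_j(1−q_j)·E[T1_j + T2_j + T3_j]` (verified as an identity on all 9 240 up-set triples × bit orders of `{0,1}³`,
6 weight vectors, and on `{0,1}⁴` samples); the per-bit terms are NOT all nonnegative (first violations on `{0,1}²`: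
`(x₀, x₀∨x₁, x₀∨x₁)`, `q = 1/3`, revealing bit 1 first gives `−8/243` of a total `52/243`), but for every triple tested
(k ≤ 3 exhaustive) SOME revelation order makes every per-bit term nonnegative — recorded, not claimed in general.

## What is formalised here

(T) holds for ANY linear functional `L` in place of the outer expectation (only linearity is used), which is how it is
stated: `sahiE_three_total_linear` — for an `ℝ`-linear `L : (β → ℝ) →ₗ[ℝ] ℝ` and fibre data `e` (`= E[f₁f₂f₃|ℱ]`),
`m_a` (`= E[f_a|ℱ]`), `cb_a` (`= E[f_bf_c|ℱ]`) as functions on the atoms `β` of `ℱ`, the identity between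
`2·L e − Σ_a L m_a · L cb_a + Π L m_a` (the unconditional `E₃` by the tower property) and the three groups of (T).
The dictionary to `Literature.Combinatorics.Sahi2008.sahiE` is `sahiE_three` / `sahiE_two` of that file (closed forms
`E₃ = 2E(fgh) + E f E g E h − Σ E f_a E(f_bf_c)`, `E₂ = E(fg) − E f E g`); the specialisation `L = ex ν` is
`sahiE_three_total_ex`, and **`sahiE_three_total`** is (T) itself for the disintegrated weight `μ(b,c) = ν(b)κ_b(c)` on a
product type (tower property `ex_prod_eq`), entirely in the `sahiE` vocabulary.
-/

namespace Summit.CriticalPhenomena.PercolationContinuityZ3.Theorems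

namespace SahiTotalE3

open Literature.Combinatorics.Sahi2008

variable {β : Type*}

/-- **Law of total `E₃`, linear-functional form.**  For any `ℝ`-linear functional `L` on functions `β → ℝ` (think
`L = E_ν`, the law of the conditioning variable) and fibre data `e = E[f₁f₂f₃|·]`, `mₐ = E[fₐ|·]`, `cb₁ = E[f₂f₃|·]`,
`cb₂ = E[f₁f₃|·]`, `cb₃ = E[f₁f₂|·]`:
`2·L e + L m₁·L m₂·L m₃ − (L m₁·L cb₁ + L m₂·L cb₂ + L m₃·L cb₃)`  (= `E₃(f)` by the tower property)
`= L(2e + m₁m₂m₃ − Σ mₐ cbₐ)`  (= `E[E₃(f|ℱ)]`)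
`+ [2·L(m₁m₂m₃) + L m₁·L m₂·L m₃ − Σ_a L mₐ · L(m_b m_c)]`  (= `E₃(m₁,m₂,m₃)`)
`+ Σ_a [L(mₐ·(cbₐ − m_b m_c)) − L mₐ · L(cbₐ − m_b m_c)]`  (= `Σ_a Cov(mₐ, K_bc)`). [this file] -/
theorem sahiE_three_total_linear (L : (β → ℝ) →ₗ[ℝ] ℝ) (e m₁ m₂ m₃ cb₁ cb₂ cb₃ : β → ℝ) :
    2 * L e + L m₁ * L m₂ * L m₃ - (L m₁ * L cb₁ + L m₂ * L cb₂ + L m₃ * L cb₃) =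
      L ((2 : ℝ) • e + m₁ * m₂ * m₃ - (m₁ * cb₁ + m₂ * cb₂ + m₃ * cb₃))
        + (2 * L (m₁ * m₂ * m₃) + L m₁ * L m₂ * L m₃
            - (L m₁ * L (m₂ * m₃) + L m₂ * L (m₁ * m₃) + L m₃ * L (m₁ * m₂)))
        + ((L (m₁ * (cb₁ - m₂ * m₃)) - L m₁ * L (cb₁ - m₂ * m₃))
            + (L (m₂ * (cb₂ - m₁ * m₃)) - L m₂ * L (cb₂ - m₁ * m₃))
            + (L (m₃ * (cb₃ - m₁ * m₂)) - L m₃ * L (cb₃ - m₁ * m₂))) := by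
  have h1 : m₂ * (m₁ * m₃) = m₁ * m₂ * m₃ := by ring
  have h2 : m₃ * (m₁ * m₂) = m₁ * m₂ * m₃ := by ring
  have h3 : m₁ * (m₂ * m₃) = m₁ * m₂ * m₃ := by ring
  simp only [mul_sub, h1, h2, h3, map_add, map_sub, map_smul, smul_eq_mul]
  ring

variable [Fintype β]

/-- The expectation `ex ν` as an `ℝ`-linear functional on `β → ℝ`. [folklore] -/
theorem ex_linear (ν : β → ℝ) : ∃ L : (β → ℝ) →ₗ[ℝ] ℝ, ∀ f, L f = ex ν f :=
  ⟨{ toFun := ex ν, map_add' := ex_add ν, map_smul' := fun c f => by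
      rw [ex_smul]; rfl }, fun _ => rfl⟩

/-- **Law of total `E₃`, expectation form.**  The identity `sahiE_three_total_linear` with `L = E_ν` (`ν` any weight on the
atoms `β` — no normalisation is needed for the identity itself; its probabilistic reading needs `ν` and the fibre laws to be
probability weights).  With `Literature.Combinatorics.Sahi2008.sahiE_three/sahiE_two` the three bracketed groups are
`E_ν[E₃(f|·)]`, `E₃^ν(m₁,m₂,m₃)` and `Σ_a E₂^ν(mₐ, K_bc)`. [this file] -/
theorem sahiE_three_total_ex (ν : β → ℝ) (e m₁ m₂ m₃ cb₁ cb₂ cb₃ : β → ℝ) :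
    2 * ex ν e + ex ν m₁ * ex ν m₂ * ex ν m₃ - (ex ν m₁ * ex ν cb₁ + ex ν m₂ * ex ν cb₂ + ex ν m₃ * ex ν cb₃) =
      ex ν ((2 : ℝ) • e + m₁ * m₂ * m₃ - (m₁ * cb₁ + m₂ * cb₂ + m₃ * cb₃))
        + sahiE ν 3 ![m₁, m₂, m₃]
        + (sahiE ν 2 ![m₁, cb₁ - m₂ * m₃] + sahiE ν 2 ![m₂, cb₂ - m₁ * m₃] + sahiE ν 2 ![m₃, cb₃ - m₁ * m₂]) := by
  obtain ⟨L, hL⟩ := ex_linear ν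
  rw [sahiE_three, sahiE_two, sahiE_two, sahiE_two]
  simp only [← hL]
  exact sahiE_three_total_linear L e m₁ m₂ m₃ cb₁ cb₂ cb₃


variable {γ : Type*} [Fintype γ]

/-- Tower property for the disintegrated weight `μ(b,c) = ν(b)·κ_b(c)`: `E_μ F = E_ν[b ↦ E_{κ_b} F(b,·)]`. [folklore] -/
theorem ex_prod_eq (ν : β → ℝ) (κ : β → γ → ℝ) (F : β × γ → ℝ) :
    ex (fun p : β × γ => ν p.1 * κ p.1 p.2) F = ex ν (fun b => ex (κ b) (fun c => F (b, c))) := by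
  simp only [ex, Fintype.sum_prod_type, Finset.mul_sum, mul_assoc]

/-- **Law of total `E₃` (T), genuine form.**  On a product type with the disintegrated weight `μ(b,c) = ν(b)κ_b(c)`
(`ν` = law of the conditioning variable, `κ_b` = conditional law on the fibre; when `Σ_c κ_b(c) = 1` the functions
`b ↦ E_{κ_b}(f b)` ARE the conditional expectations), for any `f g h : β → γ → ℝ`:
`E₃^μ(f,g,h) = E_ν[b ↦ E₃^{κ_b}(f b, g b, h b)] + E₃^ν(E_κ f, E_κ g, E_κ h) + Σ_cyc E₂^ν(E_κ f, b ↦ E₂^{κ_b}(g b, h b))`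
— an identity (no normalisation or sign hypothesis is used).  Read with `b` = the first `j` coordinates of a product
space it is the coordinate-induction skeleton for Sahi's `C₃`: the first two terms are `C₃`-instances on fewer
coordinates, the third (mixed) term is the obstruction. [this file] -/
theorem sahiE_three_total (ν : β → ℝ) (κ : β → γ → ℝ) (f g h : β → γ → ℝ) :
    sahiE (fun p : β × γ => ν p.1 * κ p.1 p.2) 3
        ![fun p => f p.1 p.2, fun p => g p.1 p.2, fun p => h p.1 p.2] =
      ex ν (fun b => sahiE (κ b) 3 ![f b, g b, h b])
        + sahiE ν 3 ![fun b => ex (κ b) (f b), fun b => ex (κ b) (g b), fun b => ex (κ b) (h b)]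
        + (sahiE ν 2 ![fun b => ex (κ b) (f b), fun b => sahiE (κ b) 2 ![g b, h b]]
            + sahiE ν 2 ![fun b => ex (κ b) (g b), fun b => sahiE (κ b) 2 ![f b, h b]]
            + sahiE ν 2 ![fun b => ex (κ b) (h b), fun b => sahiE (κ b) 2 ![f b, g b]]) := by
  have T := sahiE_three_total_ex ν (fun b => ex (κ b) (f b * g b * h b)) (fun b => ex (κ b) (f b))
    (fun b => ex (κ b) (g b)) (fun b => ex (κ b) (h b)) (fun b => ex (κ b) (g b * h b))
    (fun b => ex (κ b) (f b * h b)) (fun b => ex (κ b) (f b * g b))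
  have hfib3 : (fun b => sahiE (κ b) 3 ![f b, g b, h b]) =
      (2 : ℝ) • (fun b => ex (κ b) (f b * g b * h b))
        + (fun b => ex (κ b) (f b)) * (fun b => ex (κ b) (g b)) * (fun b => ex (κ b) (h b))
        - ((fun b => ex (κ b) (f b)) * (fun b => ex (κ b) (g b * h b))
            + (fun b => ex (κ b) (g b)) * (fun b => ex (κ b) (f b * h b))
            + (fun b => ex (κ b) (h b)) * (fun b => ex (κ b) (f b * g b))) := by
    funext b
    simp only [Pi.add_apply, Pi.sub_apply, Pi.mul_apply, Pi.smul_apply, smul_eq_mul]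
    rw [sahiE_three]
  have hfib_gh : (fun b => sahiE (κ b) 2 ![g b, h b]) =
      (fun b => ex (κ b) (g b * h b)) - (fun b => ex (κ b) (g b)) * (fun b => ex (κ b) (h b)) := by
    funext b
    simp only [Pi.sub_apply, Pi.mul_apply]
    rw [sahiE_two]
  have hfib_fh : (fun b => sahiE (κ b) 2 ![f b, h b]) =
      (fun b => ex (κ b) (f b * h b)) - (fun b => ex (κ b) (f b)) * (fun b => ex (κ b) (h b)) := by
    funext b
    simp only [Pi.sub_apply, Pi.mul_apply]
    rw [sahiE_two]
  have hfib_fg : (fun b => sahiE (κ b) 2 ![f b, g b]) =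
      (fun b => ex (κ b) (f b * g b)) - (fun b => ex (κ b) (f b)) * (fun b => ex (κ b) (g b)) := by
    funext b
    simp only [Pi.sub_apply, Pi.mul_apply]
    rw [sahiE_two]
  rw [hfib3, hfib_gh, hfib_fh, hfib_fg, sahiE_three, ex_prod_eq, ex_prod_eq, ex_prod_eq, ex_prod_eq, ex_prod_eq,
    ex_prod_eq, ex_prod_eq]
  exact T

end SahiTotalE3

end Summit.CriticalPhenomena.PercolationContinuityZ3.Theorems
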